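import Summits.CriticalPhenomena.PercolationContinuityZ3.Theorems.PercNearOneGluingNoHeavyQuantGateMoveBlobRates
import HarnessLib

/-!
# QUANT lane R8, T-DEC, leg (III): column loads of the partial flow of the blob gate move (part 2a of 3)

builds on p205010 (kernel theorem, internal audit signed; external expert review pending)

Support file (`--supports stmt-CriticalPhenomena-4575`), QUANT lane typer seat prim-quant-stmt (gen 27), rung R8 of
`run/shared/lean/prim/quant/LADDER.md`.  One theorem, standard axioms, no sorries, no definitions.  Part 1 is `…QuantGateMoveBlobRates`
(rates), part 2b `…QuantGateMoveBlobPartial` builds the partial flow whose column bookkeeping is isolated here (split off for the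
elaborator's heartbeat budget), part 3 `…QuantGateMoveBlob` is the move theorem.

THE BOUND.  At a fixed mid column `h ≤ j`, the partial flow `φ` of part 2b consists of KEPT pairs (`f l h`, or `κ·f a h` for the atom `a`)
and SLOT FILLS `R l·π·w h / W` with `w h = f 0 h + (1−κ)·f a h` (the pairs of the atom `0` and the vacated fraction of the pairs of `a`),
`π·Rtot ≤ W`, all fillers `l ≥ a`.  At the smaller target `t ≤ τ` every kept pair is cheaper (`rho_le_of_target_le`), a filler pays in a
slot at most what its owner paid at `τ` (`rho_le_rho_zero`, `rho_le_rho_of_le_low`), and the fills add up to at most the vacated loads; so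
the column load of `φ` at `t` is at most the column load of `f` at `τ`.

[this work]; flow normal form / rates: this lane (typer g22, lead g21, typer g25–g26).  The gluing rows served
[cite: KozmaNitzan2024, Conjecture 3 (p. 15)]; product measure [cite: Grimmett1999, §1.3 p. 10].
-/

noncomputable section

namespace Summit.CriticalPhenomena.PercolationContinuityZ3.Theorems

namespace Quant

open Finset

namespace LawDec

/-- **COLUMN LOADS OF THE PARTIAL FLOW** (the bookkeeping half of `gateMoveBlob_partial`, split off for the elaborator): with the
slots `w m = f 0 m + (1−κ)·f a m`, the kept pairs `kept l m` (`κ·f a m` for `l = a`, `f l m` otherwise) and the slot fills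
`R l·π·w m / W` (`π·Rtot ≤ W`, fillers `l ≥ a`), every mid column `h ≤ j` of `φ` is loaded at the smaller target `t` at most as the
same column of `f` at `τ`: kept pairs got cheaper (`rho_le_of_target_le`), a filler pays in a slot at most what its owner `0` resp. `a`
paid (`rho_le_rho_zero`, `rho_le_rho_of_le_low`), and the fills add up to at most the vacated loads. [this work] -/
theorem gateMoveBlob_col (y t τ : ℝ) (a j : ℕ) (f : ℕ → ℕ → ℝ) (κ π W Rtot : ℝ) (R w : ℕ → ℝ) (kept φ : ℕ → ℕ → ℝ)
    (hy0 : 0 < y) (hy1 : y < 1) (htτ : t ≤ τ) (ha : 1 ≤ a) (haj : a ≤ j) (hat : 2 * (a : ℝ) < t)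
    (hf0 : ∀ l h, 0 ≤ f l h)
    (hfmid : ∀ l h : ℕ, h ≤ j → 0 < f l h → τ < (l : ℝ) + h ∧ 2 * (l : ℝ) < τ ∧ l < h)
    (hκ0 : 0 ≤ κ) (hκ1 : κ ≤ 1) (hπ0 : 0 ≤ π) (hW0 : 0 ≤ W) (hπR : π * Rtot ≤ W)
    (hR0 : ∀ l, 0 ≤ R l) (hRge : ∀ l : ℕ, 1 ≤ l → 0 < R l → a ≤ l)
    (hRtot : Rtot = ∑ l ∈ Finset.range (j + 1), (if (1 ≤ l ∧ 2 * (l : ℝ) < t) then R l else 0))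
    (hw : ∀ m, w m = f 0 m + (1 - κ) * f a m)
    (hkept : ∀ l m, kept l m = if l = a then κ * f a m else f l m)
    (hφin : ∀ l m, (1 ≤ l ∧ l ≤ j ∧ 2 * (l : ℝ) < t) → m ≤ j → φ l m = kept l m + R l * π * w m / W)
    (hφout : ∀ l m, ¬ ((1 ≤ l ∧ l ≤ j ∧ 2 * (l : ℝ) < t) ∧ m ≤ j) → φ l m = 0) :
    ∀ h, h ≤ j → ∑ l ∈ Finset.range (j + 1), usage y t j l h * φ l h
      ≤ ∑ l ∈ Finset.range (j + 1), usage y τ j l h * f l h := by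
  have ha0' : a ≠ 0 := by omega
  intro h hhj
  have cmp_same : ∀ l : ℕ, 0 < f l h → usage y t j l h ≤ usage y τ j l h := by
    intro l hp
    obtain ⟨hc, hl2, hlh⟩ := hfmid l h hhj hp
    exact usage_le_of_rho_le y t τ j l l h hy0 hy1 hhj hl2 hc (rho_le_of_target_le t τ l h hlh htτ)
  have cmp_zero : ∀ l : ℕ, 2 * (l : ℝ) < t → 0 < f 0 h → usage y t j l h ≤ usage y τ j 0 h := by
    intro l hl2 hp
    obtain ⟨hc, h02, _⟩ := hfmid 0 h hhj hp
    have hτh : τ ≤ 2 * (h : ℝ) := by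
      push_cast at hc; linarith [(Nat.cast_nonneg h : (0 : ℝ) ≤ h)]
    exact usage_le_of_rho_le y t τ j l 0 h hy0 hy1 hhj h02 hc (rho_le_rho_zero t τ l h htτ hl2 hτh)
  have cmp_a : ∀ l : ℕ, a ≤ l → 2 * (l : ℝ) < t → 0 < f a h → usage y t j l h ≤ usage y τ j a h := by
    intro l hal hl2 hp
    obtain ⟨hc, ha2, _⟩ := hfmid a h hhj hp
    have hτh : τ ≤ 2 * (h : ℝ) := by linarith
    have hlh : l < h := by
      have : (l : ℝ) < h := by linarith
      exact_mod_cast this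
    exact usage_le_of_rho_le y t τ j l a h hy0 hy1 hhj ha2 hc (rho_le_rho_of_le_low t τ a l h htτ hal hlh hτh)
  have hupos : ∀ l : ℕ, 0 ≤ usage y τ j l h * f l h := by
    intro l
    rcases (hf0 l h).eq_or_lt with h0 | hp
    · rw [← h0, mul_zero]
    · obtain ⟨hc, hl2, hlh⟩ := hfmid l h hhj hp
      exact mul_nonneg (usage_pos_of_compat y τ j l h hy0 hy1 hl2 hlh (Or.inr hc)).le hp.le
  -- what the two slot owners paid in this column
  obtain ⟨ω, hω⟩ : ∃ ω : ℝ, ω = usage y τ j 0 h * f 0 h + (1 - κ) * (usage y τ j a h * f a h) := ⟨_, rfl⟩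
  have hω0 : 0 ≤ ω := by rw [hω]; exact add_nonneg (hupos 0) (mul_nonneg (by linarith) (hupos a))
  have hslotprice : ∀ l : ℕ, 1 ≤ l → 2 * (l : ℝ) < t → 0 < R l → usage y t j l h * w h ≤ ω := by
    intro l hl1 hl2 hRl
    have hla : a ≤ l := hRge l hl1 hRl
    rw [hw, hω, mul_add]
    refine add_le_add ?_ ?_
    · rcases (hf0 0 h).eq_or_lt with h0 | hp
      · rw [← h0, mul_zero, mul_zero]
      · exact mul_le_mul_of_nonneg_right (cmp_zero l hl2 hp) hp.le
    · rw [← mul_assoc, mul_comm (usage y t j l h) (1 - κ), mul_assoc]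
      refine mul_le_mul_of_nonneg_left ?_ (by linarith)
      rcases (hf0 a h).eq_or_lt with h0 | hp
      · rw [← h0, mul_zero, mul_zero]
      · exact mul_le_mul_of_nonneg_right (cmp_a l hla hl2 hp) hp.le
  -- termwise bound: kept pair + slot fill
  obtain ⟨A, hA⟩ : ∃ A : ℕ → ℝ, ∀ l, A l =
      if (1 ≤ l ∧ l ≤ j ∧ 2 * (l : ℝ) < t) then (if l = a then κ else 1) * (usage y τ j l h * f l h) else 0 :=
    ⟨_, fun l => rfl⟩
  obtain ⟨B, hB⟩ : ∃ B : ℕ → ℝ, ∀ l, B l =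
      if (1 ≤ l ∧ l ≤ j ∧ 2 * (l : ℝ) < t) then R l * π / W * ω else 0 := ⟨_, fun l => rfl⟩
  have hL : ∀ l ∈ Finset.range (j + 1), usage y t j l h * φ l h ≤ A l + B l := by
    intro l _
    rw [hA, hB]
    by_cases hc : (1 ≤ l ∧ l ≤ j ∧ 2 * (l : ℝ) < t)
    · rw [if_pos hc, if_pos hc, hφin l h hc hhj, mul_add]
      refine add_le_add ?_ ?_
      · -- the kept pair
        rw [hkept]
        by_cases hla : l = a
        · rw [if_pos hla, if_pos hla, hla]
          rcases (hf0 a h).eq_or_lt with h0 | hp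
          · simp only [← h0, mul_zero, le_refl]
          · have h1 := mul_le_mul_of_nonneg_right (cmp_same a hp) hp.le
            have e1 : usage y t j a h * (κ * f a h) = κ * (usage y t j a h * f a h) := by ring
            rw [e1]
            exact mul_le_mul_of_nonneg_left h1 hκ0
        · rw [if_neg hla, if_neg hla, one_mul]
          rcases (hf0 l h).eq_or_lt with h0 | hp
          · simp only [← h0, mul_zero, le_refl]
          · exact mul_le_mul_of_nonneg_right (cmp_same l hp) hp.le
      · -- the slot fill
        rcases (hR0 l).eq_or_lt with hR0' | hRl
        · simp only [← hR0', zero_mul, zero_div, mul_zero, le_refl]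
        · have e : usage y t j l h * (R l * π * w h / W) = R l * π / W * (usage y t j l h * w h) := by ring
          rw [e]
          exact mul_le_mul_of_nonneg_left (hslotprice l hc.1 hc.2.2 hRl)
            (div_nonneg (mul_nonneg (hR0 l) hπ0) hW0)
    · rw [if_neg hc, if_neg hc, hφout l h (fun h' => hc h'.1), mul_zero, add_zero]
  refine (Finset.sum_le_sum hL).trans ?_
  rw [Finset.sum_add_distrib]
  -- the slot fills add up to at most `ω`
  have hBsum : ∑ l ∈ Finset.range (j + 1), B l ≤ ω := by
    have e : ∀ l ∈ Finset.range (j + 1), B l = (π * ω / W) * (if (1 ≤ l ∧ 2 * (l : ℝ) < t) then R l else 0) := by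
      intro l hl
      have hlj : l ≤ j := Nat.lt_succ_iff.1 (Finset.mem_range.1 hl)
      rw [hB]
      by_cases hc : 1 ≤ l ∧ 2 * (l : ℝ) < t
      · rw [if_pos ⟨hc.1, hlj, hc.2⟩, if_pos hc]; ring
      · rw [if_neg (fun h' => hc ⟨h'.1, h'.2.2⟩), if_neg hc, mul_zero]
    rw [Finset.sum_congr rfl e, ← Finset.mul_sum, ← hRtot]
    rcases hW0.eq_or_lt with hW0' | hWpos
    · rw [← hW0', div_zero, zero_mul]; exact hω0
    · calc π * ω / W * Rtot = ω / W * (π * Rtot) := by ring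
        _ ≤ ω / W * W := mul_le_mul_of_nonneg_left hπR (div_nonneg hω0 hW0)
        _ = ω := div_mul_cancel₀ _ (ne_of_gt hWpos)
  -- the kept pairs plus `ω` are at most the column of `f`
  have hAsum : ∑ l ∈ Finset.range (j + 1), A l + ω ≤ ∑ l ∈ Finset.range (j + 1), usage y τ j l h * f l h := by
    obtain ⟨D, hD⟩ : ∃ D : ℕ → ℝ, ∀ l, D l = usage y τ j l h * f l h - A l := ⟨_, fun l => rfl⟩
    have hD0 : ∀ l, 0 ≤ D l := by
      intro l; rw [hD, hA]
      by_cases hc : (1 ≤ l ∧ l ≤ j ∧ 2 * (l : ℝ) < t)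
      · rw [if_pos hc]
        by_cases hla : l = a
        · rw [if_pos hla]
          have := mul_nonneg (sub_nonneg.2 hκ1) (hupos l)
          linarith
        · rw [if_neg hla]; linarith [hupos l]
      · rw [if_neg hc]; linarith [hupos l]
    have hDsum : ∑ l ∈ Finset.range (j + 1), D l
        = ∑ l ∈ Finset.range (j + 1), usage y τ j l h * f l h - ∑ l ∈ Finset.range (j + 1), A l := by
      rw [← Finset.sum_sub_distrib]
      exact Finset.sum_congr rfl fun l _ => hD l
    have hc0 : ¬ (1 ≤ (0 : ℕ) ∧ (0 : ℕ) ≤ j ∧ 2 * ((0 : ℕ) : ℝ) < t) := fun hc => absurd hc.1 (by norm_num)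
    have hD0' : D 0 = usage y τ j 0 h * f 0 h := by rw [hD, hA, if_neg hc0, sub_zero]
    have hDa' : D a = (1 - κ) * (usage y τ j a h * f a h) := by
      rw [hD, hA, if_pos ⟨ha, haj, hat⟩, if_pos rfl]; ring
    have hD0a : D 0 + D a = ω := by rw [hD0', hDa', hω]
    have hsub : ({0, a} : Finset ℕ) ⊆ Finset.range (j + 1) := by
      intro l hl
      rw [Finset.mem_insert, Finset.mem_singleton] at hl
      rw [Finset.mem_range]
      rcases hl with hl | hl <;> omega
    have hpair := Finset.sum_le_sum_of_subset_of_nonneg hsub (fun l _ _ => hD0 l)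
    rw [Finset.sum_pair (Ne.symm ha0'), hD0a, hDsum] at hpair
    linarith
  linarith [hAsum, hBsum]

end LawDec

end Quant

end Summit.CriticalPhenomena.PercolationContinuityZ3.Theorems
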